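import Literature.Barriers.Schanuel.EFunctionValuesAtAlgebraicPointsKrylov
import Literature.Barriers.Schanuel.EFunctionValuesAtAlgebraicPointsSteps
import Literature.Barriers.Schanuel.EFunctionValuesAtAlgebraicPointsHeight
import Literature.Barriers.Schanuel.EFunctionValuesAtAlgebraicPointsMonomials
import Mathlib.Tactic.Lift
import HarnessLib

/-!
# Barrier (Schanuel) `EFunctionValuesAtAlgebraicPoints`: Shidlovskii's lemma (Baker Ch. 11, Lemma 2; Rivoal Lemme 5.15) — proofs only

`Literature/Barriers/Schanuel/EFunctionValuesAtAlgebraicPointsShidlovskii.lean` — sibling file of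
`EFunctionValuesAtAlgebraicPoints.lean` in the programme to discharge `siegelShidlovskii_algIndep`
(Siegel–Shidlovskii; Rivoal Thm. 5.10 = Baker Thm. 11.1). It PROVES Shidlovskii's lemma —
"Shidlovsky's major discovery in the subject" (Baker, *Transcendental Number Theory*, Ch. 11,
Lemma 2, pp. 110–111; Rivoal, Lemme 5.15: "Le déterminant de la matrice `(P_{k,j,r}(z))` n'est
pas identiquement nul") — in the following zero-estimate form, which is what Baker's proof
establishes:

`SiegelShidlovskii.shidlovskii_lemma`: let `E₁, …, Eₙ ∈ K⟦X⟧` (`char K = 0`) solve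
`f Eᵢ′ = ∑ⱼ Gᵢⱼ Eⱼ` with `f ≠ 0` and be linearly independent over `K[X]`. There is a constant `C`
(depending on `f, G, E` only) such that for every `r` and every non-zero `P ∈ K[X]ⁿ` with
`deg Pᵢ ≤ r`: if `∑ Pᵢ Eᵢ` vanishes at `0` to order `> (n − 1) r + C` then Baker's determinant
`Δ(P) = det (P_{ij})` is not zero. (With Baker's `M = n(r+1) − 1 − [εr]` the hypothesis holds
for `r ≫ 1`, which is how Lemma 2 is applied.)

The proof is Baker's, assembled from the sibling files: the Krylov index `k < n` of a vanishing
`Δ` and the relation `d q_k = ∑ c_j q_j` (…Krylov), the fundamental solutions `W` at a regular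
point `z₀` and the `n − k` kernel solutions `N` with `N Q = 0` (…Solutions, …Wronski, …Krylov),
`SR⁻¹ = −V⁻¹U` (…Steps), the fixed finite-dimensional span of monomials in the entries of `W`
containing `det V` and `adj(V)U` (…Monomials) and the resulting bounded heights `q S = H R`
(…Height, …Steps), the identity `det R · (qA + BH) = q · L adj R` (…Steps), and finally the
comparison of vanishing orders using the bounded-order lemma for forms of bounded degree
(…Height) against `ord L_j ≥ ord(∑PᵢEᵢ) − j` (…Forms).

All [folklore]-tagged lemmas are routine; the main theorem carries the citation.

## References

* A. Baker, *Transcendental Number Theory*, CUP 1975, Ch. 11 §2, Lemma 2 (pp. 110–111).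
* [Rivoal2024] T. Rivoal, *Les E-fonctions et G-fonctions de Siegel* (2024), Lemme 5.15.
-/

noncomputable section

open Polynomial PowerSeries Matrix

namespace Literature.Barriers.Schanuel

namespace SiegelShidlovskii

variable {K : Type*} [Field K] {n : ℕ}

/-! ### 1. Letters: the entries of `W` together with `1` -/

/-- The letters of the monomial span: `none ↦ 1`, `some (l, i) ↦ W l i`. [folklore] -/
def letterOf (W : Fin n → Fin n → PowerSeries K) : Option (Fin n × Fin n) → PowerSeries K
  | none => 1
  | some p => W p.1 p.2

/-- The letter `none` is `1`. [folklore] -/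
theorem letterOf_none (W : Fin n → Fin n → PowerSeries K) : letterOf W none = 1 := rfl

/-- Entries of vectors in the `K`-span of the `W l` are `K`-combinations of letters. [folklore] -/
theorem entry_mem_monSpan_one {W : Fin n → Fin n → PowerSeries K} {y : Fin n → PowerSeries K}
    (hy : y ∈ Submodule.span K (Set.range W)) (i : Fin n) :
    y i ∈ monSpan (K := K) (letterOf W) 1 := by
  rw [monSpan, pow_one]
  obtain ⟨κ, rfl⟩ := (Submodule.mem_span_range_iff_exists_fun K).mp hy
  rw [Finset.sum_apply]
  refine Submodule.sum_mem _ fun l _ => ?_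
  rw [Pi.smul_apply]
  exact Submodule.smul_mem _ _ (Submodule.subset_span ⟨some (l, i), rfl⟩)

/-! ### 2. Small lemmas on orders and degrees -/

/-- A non-zero polynomial, as a power series, has order `≤` its degree. [folklore] -/
theorem order_coe_le_natDegree {p : K[X]} (hp : p ≠ 0) :
    ((p : PowerSeries K)).order ≤ p.natDegree :=
  PowerSeries.order_le _ (by rw [Polynomial.coeff_coe]; exact Polynomial.leadingCoeff_ne_zero.mpr hp)

/-- `orderGE N` is stable under multiplication by anything. [folklore] -/
theorem mul_mem_orderGE {N : ℕ} {F : PowerSeries K} (hF : F ∈ orderGE (K := K) N)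
    (G : PowerSeries K) : F * G ∈ orderGE (K := K) N :=
  le_trans hF (le_trans le_self_add (PowerSeries.le_order_mul F G))

/-- `orderGE N` is stable under multiplication by anything (left factor). [folklore] -/
theorem mul_mem_orderGE' {N : ℕ} (G : PowerSeries K) {F : PowerSeries K}
    (hF : F ∈ orderGE (K := K) N) : G * F ∈ orderGE (K := K) N := by
  rw [mul_comm]; exact mul_mem_orderGE hF G

/-- Degree of `det R_I` for the Krylov columns: `≤ k r + n² m`. [folklore] -/
theorem natDegree_det_kry_le (f : K[X]) (G : Matrix (Fin n) (Fin n) K[X]) {P : Fin n → K[X]}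
    {r : ℕ} (hdeg : ∀ i, (P i).natDegree ≤ r) {k : ℕ} (hkn : k ≤ n) (I : Fin k → Fin n) :
    ((Matrix.of fun j' (j : Fin k) => kryVec f G P j (I j')).det).natDegree ≤
      k * r + n * n * sysDeg f G := by
  refine (natDegree_det_le_of_column _ (fun j : Fin k => r + (j : ℕ) * sysDeg f G)
    fun j' j => ?_).trans ?_
  · rw [Matrix.of_apply]
    exact natDegree_dualD_iterate_le f G hdeg j (I j')
  · calc ∑ j : Fin k, (r + (j : ℕ) * sysDeg f G) ≤ ∑ _j : Fin k, (r + n * sysDeg f G) :=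
          Finset.sum_le_sum fun j _ => Nat.add_le_add_left
            (Nat.mul_le_mul_right _ (le_trans j.isLt.le hkn)) _
      _ = k * r + k * (n * sysDeg f G) := by
          rw [Finset.sum_const, Finset.card_univ, Fintype.card_fin, smul_eq_mul, mul_add]
      _ ≤ k * r + n * n * sysDeg f G := by
          rw [mul_assoc]
          exact Nat.add_le_add_left (Nat.mul_le_mul_right _ hkn) _

/-- Unpacking an inequality `N₁ ≤ a + b` in `ℕ∞` with `a ≤ s₀`, `b < N₀`. [folklore] -/
theorem enat_unpack {N₁ s₀ N₀ : ℕ} {a b : ℕ∞} (ha : a ≤ (s₀ : ℕ∞)) (hb : b < (N₀ : ℕ∞))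
    (h : (N₁ : ℕ∞) ≤ a + b) : ∃ s t : ℕ, s ≤ s₀ ∧ t < N₀ ∧ N₁ ≤ s + t := by
  have ha' : a ≠ ⊤ := ne_top_of_le_ne_top (ENat.coe_ne_top _) ha
  have hb' : b ≠ ⊤ := ne_top_of_lt hb
  lift a to ℕ using ha'
  lift b to ℕ using hb'
  exact ⟨a, b, by exact_mod_cast ha, by exact_mod_cast hb, by exact_mod_cast h⟩

/-- The final arithmetic. [folklore] -/
theorem final_contradiction {n k r m N₀ s t : ℕ} (hkn : k < n)
    (hs : s ≤ k * r + n * n * m) (ht : t < N₀)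
    (hle : (n - 1) * r + (n * n * m + N₀ + n) + 2 - n ≤ s + t) : False := by
  have hkr : k * r ≤ (n - 1) * r := Nat.mul_le_mul_right r (Nat.le_sub_one_of_lt hkn)
  omega

/-! ### 3. Shidlovskii's lemma -/

/-- **Shidlovskii's lemma** (Baker, *Transcendental Number Theory*, Ch. 11, Lemma 2; Rivoal,
Lemme 5.15), zero-estimate form. Let `E₁, …, Eₙ ∈ K⟦X⟧` (`char K = 0`) satisfy
`f · Eᵢ′ = ∑ⱼ Gᵢⱼ Eⱼ` with `f ≠ 0`, and be linearly independent over `K[X]`. Then there is a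
constant `C` such that for all `r` and all non-zero `P ∈ K[X]ⁿ` with `deg Pᵢ ≤ r`: if
`ord₀ (∑ Pᵢ Eᵢ) > (n − 1) r + C` then the determinant `Δ(P)` of the derived coefficient vectors
`P, dualD P, …, dualD^{n-1} P` is non-zero. [cite: Rivoal2024, Lemme 5.15] -/
theorem shidlovskii_lemma [CharZero K] {f : K[X]} {G : Matrix (Fin n) (Fin n) K[X]}
    {E : Fin n → PowerSeries K} (hf : f ≠ 0)
    (hE : IsSol (coeAlgHom K) (PowerSeries.derivative K) f G E)
    (hind : ∀ p : Fin n → K[X], form (coeAlgHom K) E p = 0 → p = 0) :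
    ∃ C : ℕ, ∀ (r : ℕ) (P : Fin n → K[X]), P ≠ 0 → (∀ i, (P i).natDegree ≤ r) →
      (((n - 1) * r + C : ℕ) : ℕ∞) < (form (coeAlgHom K) E P).order → Δ f G P ≠ 0 := by
  classical
  -- Step 0: the constants (independent of `r`, `P`)
  obtain ⟨z₀, hz₀⟩ := exists_eval_ne_zero hf
  obtain ⟨S, hS⟩ := monSpan_fg (K := K) (letterOf (fundSol f G hz₀)) n
  set b : Fin S.card → PowerSeries K := fun i => ((S.equivFin.symm i : S) : PowerSeries K) with hb
  have hbspan : Submodule.span K (Set.range b) = monSpan (K := K) (letterOf (fundSol f G hz₀)) n := by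
    rw [← hS]
    congr 1
    ext x
    constructor
    · rintro ⟨i, rfl⟩
      exact (S.equivFin.symm i).2
    · intro hx
      exact ⟨S.equivFin ⟨x, hx⟩, by simp [hb]⟩
  obtain ⟨c₁, hc₁⟩ := exists_height_bound (shiftAlgHom K z₀) (shiftAlgHom_injective K z₀) b
  obtain ⟨N₀, hN₀⟩ := exists_order_lt_of_indep E hind (c₁ + n * n * c₁)
  refine ⟨n * n * sysDeg f G + N₀ + n, fun r P hP hdeg hord hΔ => ?_⟩
  -- Step 1: `n > 0` and the Krylov index `1 ≤ k < n`
  have hn : 0 < n := by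
    rcases Nat.eq_zero_or_pos n with h0 | h0
    · subst h0
      exact absurd (funext fun i => Fin.elim0 i) hP
    · exact h0
  have hk1 : 1 ≤ kryIndex f G P := kryIndex_pos f G P hP
  have hkn : kryIndex f G P < n := kryIndex_lt_of_Δ_eq_zero f G P hn hΔ
  obtain ⟨dq, cq, hdq, hrel⟩ := kry_relation f G P
  set Q : Matrix (Fin n) (Fin (kryIndex f G P)) K[X] := fun i j => kryVec f G P j i with hQ
  have hQind : LinearIndependent K[X] (fun j : Fin (kryIndex f G P) => fun i : Fin n => Q i j) :=
    kry_indep f G P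
  obtain ⟨I, hI, hdetR⟩ := exists_submatrix_det_ne_zero Q hQind
  obtain ⟨J, hs⟩ := exists_isRowSplit I hI
  -- Step 2: the kernel solutions `N` (`N Q = 0`), `det V ≠ 0`, `SR⁻¹ = −V⁻¹U`
  have he : shiftAlgHom K z₀ dq * shiftAlgHom K z₀ f ≠ 0 :=
    mul_ne_zero (fun h => hdq (shiftAlgHom_injective K z₀ (by rw [h, map_zero])))
      (isUnit_shiftAlgHom K hz₀).ne_zero
  obtain ⟨N, hNmem, hNker, hNind⟩ := exists_kernel_solutions_regular f G hz₀
    (fun j : Fin (kryIndex f G P) => kryVec f G P j) _ he (kryCompanion (z₀ := z₀) dq cq)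
    (fun y hy => derivClosed_formVec_kry hrel hy)
  have hNQ : (Matrix.of N) * Q.map (shiftAlgHom K z₀) = 0 := by
    refine Matrix.ext fun l j => ?_
    rw [Matrix.mul_apply, Matrix.zero_apply, ← hNker l j, form]
    refine Finset.sum_congr rfl fun i _ => ?_
    rw [Matrix.of_apply, Matrix.map_apply, mul_comm]
  obtain ⟨hdetV, hident⟩ := kernel_matrix_step (shiftAlgHom K z₀) (shiftAlgHom_injective K z₀) hs
    Q hdetR (Matrix.of N) hNind hNQ
  -- Step 3: memberships in the fixed span and bounded heights
  have hNentry : ∀ l i, (Matrix.of N) l i ∈ monSpan (K := K) (letterOf (fundSol f G hz₀)) 1 :=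
    fun l i => entry_mem_monSpan_one (hNmem l) i
  have hVmem : ((Matrix.of N).submatrix id J).det ∈ Submodule.span K (Set.range b) := by
    rw [hbspan]
    exact det_mem_monSpan_of_le _ (letterOf_none _) (Nat.sub_le n _) _ fun i j => hNentry _ _
  have hUmem : ∀ l j, (-(((Matrix.of N).submatrix id J).adjugate * (Matrix.of N).submatrix id I)) l j
      ∈ Submodule.span K (Set.range b) := by
    intro l j
    rw [hbspan, Matrix.neg_apply]
    refine Submodule.neg_mem _ (monSpan_mono _ (letterOf_none _)
      (by omega : n - kryIndex f G P + 1 ≤ n) ?_)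
    exact adjugate_mul_apply_mem_monSpan _ (letterOf_none _) _ _ (fun i j => hNentry _ _)
      (fun i b => hNentry _ _) l j
  have hpq : ∀ l j, ∃ p q : K[X], q ≠ 0 ∧ p.natDegree ≤ c₁ ∧ q.natDegree ≤ c₁ ∧
      (Q.submatrix J id * (Q.submatrix I id).adjugate) l j * q = (Q.submatrix I id).det * p :=
    fun l j => hc₁ _ (hUmem l j) _ hVmem hdetV _ _ (hident l j)
  choose pm qm hqm0 hdegp hdegq hpq' using hpq
  obtain ⟨qAll, Hm, hqAll0, hdegqAll, hdegH, hSH⟩ :=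
    common_denominator_step (Q.submatrix I id) hdetR (Q.submatrix J id) c₁ pm qm hqm0 hdegp hdegq hpq'
  -- Step 4: the form identity `det R · Φ = q · L adj R` at the column `j₀ = 0`
  set j₀ : Fin (kryIndex f G P) := ⟨0, hk1⟩ with hj₀
  set φ : Fin n → K[X] := Pi.single (I j₀) qAll + ∑ l, Pi.single (J l) (Hm l j₀) with hφ
  have hφ0 : φ ≠ 0 := by
    intro h
    have := congr_fun h (I j₀)
    rw [hφ, phi_apply_I hs] at this
    exact hqAll0 this
  have hkk : (n - kryIndex f G P) * kryIndex f G P ≤ n * n := Nat.mul_le_mul (Nat.sub_le n _) hkn.le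
  have hφdeg : ∀ i, (φ i).natDegree ≤ c₁ + n * n * c₁ := by
    intro i
    refine natDegree_phi_le qAll Hm j₀ ?_ (fun l => ?_) i
    · calc qAll.natDegree ≤ (n - kryIndex f G P) * kryIndex f G P * c₁ := hdegqAll
        _ ≤ n * n * c₁ := Nat.mul_le_mul_right _ hkk
        _ ≤ c₁ + n * n * c₁ := Nat.le_add_left _ _
    · exact (hdegH l j₀).trans (Nat.add_le_add_left (Nat.mul_le_mul_right _ hkk) _)
  have hident2 := vecMul_adjugate_step (coeAlgHom K) hs Q qAll Hm hSH E j₀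
  rw [← form_phi (coeAlgHom K) E qAll Hm j₀] at hident2
  -- Step 5: orders.  RHS vanishes to order `≥ N₁`
  have hN₁ : ∀ j : Fin (kryIndex f G P), form (coeAlgHom K) E (kryVec f G P j) ∈
      orderGE (K := K) ((n - 1) * r + (n * n * sysDeg f G + N₀ + n) + 2 - n) := by
    intro j
    apply le_order_form_dualD_iterate hE P (j : ℕ)
    have h1 := (ENat.add_one_le_iff (ENat.coe_ne_top _)).mpr hord
    refine le_trans ?_ h1
    have hj : (j : ℕ) < n := lt_trans j.isLt hkn
    exact_mod_cast (by omega :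
      (n - 1) * r + (n * n * sysDeg f G + N₀ + n) + 2 - n + (j : ℕ) ≤
        (n - 1) * r + (n * n * sysDeg f G + N₀ + n) + 1)
  have hRHS : coeAlgHom K qAll *
      ((E ᵥ* Q.map (coeAlgHom K)) ᵥ* ((Q.submatrix I id).map (coeAlgHom K)).adjugate) j₀ ∈
      orderGE (K := K) ((n - 1) * r + (n * n * sysDeg f G + N₀ + n) + 2 - n) := by
    refine mul_mem_orderGE' _ ?_
    change (∑ j, (E ᵥ* Q.map (coeAlgHom K)) j *
      ((Q.submatrix I id).map (coeAlgHom K)).adjugate j j₀) ∈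
        orderGE (K := K) ((n - 1) * r + (n * n * sysDeg f G + N₀ + n) + 2 - n)
    refine Submodule.sum_mem _ fun j _ => mul_mem_orderGE ?_ _
    rw [vecMul_map_eq_form]
    exact hN₁ j
  rw [← hident2] at hRHS
  -- LHS: `ord (det R) + ord Φ`, with `ord (det R) ≤ deg det R ≤ k r + n² m` and `ord Φ < N₀`
  have hLHS : (((n - 1) * r + (n * n * sysDeg f G + N₀ + n) + 2 - n : ℕ) : ℕ∞) ≤
      ((Q.submatrix I id).det : PowerSeries K).order + (form (coeAlgHom K) E φ).order := by
    rw [← PowerSeries.order_mul]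
    exact hRHS
  have hordR : ((Q.submatrix I id).det : PowerSeries K).order ≤
      ((kryIndex f G P * r + n * n * sysDeg f G : ℕ) : ℕ∞) := by
    refine (order_coe_le_natDegree hdetR).trans ?_
    exact_mod_cast natDegree_det_kry_le f G hdeg hkn.le I
  have hordΦ : (form (coeAlgHom K) E φ).order < N₀ := hN₀ φ hφ0 hφdeg
  obtain ⟨s, t, hs', ht, hle⟩ := enat_unpack hordR hordΦ hLHS
  exact final_contradiction hkn hs' ht hle

end SiegelShidlovskii

end Literature.Barriers.Schanuel

end
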